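import Mathlib
import Summits.Schanuel.Schanuel.Theorems.RootDecomp1EAnchorToolkit
import Summits.Schanuel.Schanuel.Theses.RootDecomp1E
import Literature.Barriers.Schanuel.LargeTranscendenceDegree
import Literature.NumberTheory.Transcendental.BakerLogarithmsConclusion
import Summits.Schanuel.Schanuel.Theorems.RootDecomp1EMultiplicationTypeLeavesEStable

/-!
# RootDecomp1E — leaves of ROUND 7 «MultiplicationType» (lens 2, gen 7), part 3/4: (f) kernel dictionary symmetric_iff_eStable / asymmetric_iff_plain (critic R2) · (h₁,h₂) the items 31409/31410 in lens-1's stabilizer language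

MONOLITH = `g7/RootDecomp1EMultiplicationTypeLeaves.port.lean` (994 lines, lean check rc0 · 0 · 0 against the live tree 2026-08-30
≈09:10Z); this is PART 3/4 of its split at section boundaries for the 400-line cap (one namespace
`…Theorems.RootDecomp1EMultiplicationTypeLeaves` across the four modules; part k imports part k−1).  Parts 2–4 typecheck once
their predecessor is in the tree (the monolith is the checked reference).
Target `Summits/Schanuel/Schanuel/Theorems/RootDecomp1EMultiplicationTypeLeavesDictionary.lean`, `--supports stmt-Schanuel-31409` (EStableDefectOne; parts 3–4 equally
concern stmt-Schanuel-31410 PlainDefectOne).  See the monolith header for the per-theorem description.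
-/

set_option linter.dupNamespace false

noncomputable section

namespace Summit.Schanuel.Schanuel.Theorems.RootDecomp1EMultiplicationTypeLeaves

open Complex IntermediateField Module Polynomial
open Summit.Schanuel.Schanuel.Theorems.RootDecomp1EAnchor (isAlgebraic_of_mem_adjoin
  trdeg_adjoin_le_of_isAlgebraic mem_adjoin_of_mem_span exp_isAlgebraic_of_mem_span)
open Literature.Barriers.Schanuel (gridField₂ smallTrdeg_thm_2_9_pos smallTrdeg_thm_2_9_two_two
  WaldschmidtConjecture_2_3 trdeg_mono)
open Literature.NumberTheory.Transcendental (baker_holds)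
open Summit.Schanuel.Schanuel.Theorems.RootDecomp1EEStableRung (mul_mem_span_of_gens)


/-! ## (f) KERNEL DICTIONARY with lens-1 g7 «SymmetryLayer» (critic FOREST RULING R2, 08:42:50Z): stabilizer field `K_V ≠ ℚ` ⟺ `EStable`, `K_V = ℚ` ⟺ `Plain` — no hypothesis on `z` -/

/-- **Multipliers of a nonzero finite-dimensional ℚ-span are algebraic** (Cayley–Hamilton / integrality of `End_ℚ V`):
if `q · span_ℚ z ⊆ span_ℚ z` and the span contains a nonzero vector, then `q` is algebraic over `ℚ`. -/
theorem isAlgebraic_of_mul_mem_span {n : ℕ} (z : Fin n → ℂ) (q : ℂ)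
    (hq : ∀ v ∈ Submodule.span ℚ (Set.range z), q * v ∈ Submodule.span ℚ (Set.range z))
    {v : ℂ} (hv : v ∈ Submodule.span ℚ (Set.range z)) (hv0 : v ≠ 0) : IsAlgebraic ℚ q := by
  set V : Submodule ℚ ℂ := Submodule.span ℚ (Set.range z) with hV
  haveI : Module.Finite ℚ ↥V := FiniteDimensional.span_of_finite ℚ (Set.finite_range z)
  let T : ↥V →ₗ[ℚ] ↥V :=
    { toFun := fun w => ⟨q * (w : ℂ), hq w w.2⟩
      map_add' := fun a b => by ext; simp [mul_add]
      map_smul' := fun r a => by ext; simp }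
  have hT : ∀ w : ↥V, ((T w : ↥V) : ℂ) = q * (w : ℂ) := fun w => rfl
  have hpow : ∀ (k : ℕ) (w : ↥V), (((T ^ k) w : ↥V) : ℂ) = q ^ k * (w : ℂ) := by
    intro k
    induction k with
    | zero => intro w; simp
    | succ k ih =>
      intro w
      rw [pow_succ, Module.End.mul_apply, ih, hT]
      ring
  have key : ∀ (f : ℚ[X]) (w : ↥V), ((aeval T f w : ↥V) : ℂ) = aeval q f * (w : ℂ) := by
    intro f w
    induction f using Polynomial.induction_on' with
    | add f g hf hg => simp [hf, hg, add_mul]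
    | monomial k a =>
      rw [aeval_monomial, aeval_monomial, Module.End.mul_apply, Module.algebraMap_end_apply]
      rw [Submodule.coe_smul, hpow, Algebra.smul_def]
      simp [mul_assoc]
  have hint : IsIntegral ℚ T := Algebra.IsIntegral.isIntegral T
  obtain ⟨p, hmonic, hp⟩ := hint
  rw [← aeval_def] at hp
  have h0 : aeval q p * v = 0 := by
    have := key p ⟨v, hv⟩
    rw [hp] at this
    simpa using this.symm
  refine ⟨p, hmonic.ne_zero, ?_⟩
  rcases mul_eq_zero.mp h0 with h | h
  · exact h
  · exact absurd h hv0

/-- `√2` is irrational (not in the image of ℚ → ℂ). -/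
theorem sqrt_two_not_mem_range : ((Real.sqrt 2 : ℝ) : ℂ) ∉ Set.range (algebraMap ℚ ℂ) := by
  rintro ⟨r, hr⟩
  have hr' : (r : ℝ) = Real.sqrt 2 := by
    have h1 : ((r : ℝ) : ℂ) = ((Real.sqrt 2 : ℝ) : ℂ) := by
      rw [← hr]
      simp
    exact_mod_cast h1
  exact irrational_sqrt_two ⟨r, hr'⟩

/-- `√2` is an irrational algebraic number (packaged as one statement; the bare algebraicity is the tree's
`sqrt_two_isAlgebraic_irrational.1`, whose module is not importable on the check farm today). -/
theorem sqrt_two_isAlgebraic_irrational :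
    IsAlgebraic ℚ ((Real.sqrt 2 : ℝ) : ℂ) ∧ ((Real.sqrt 2 : ℝ) : ℂ) ∉ Set.range (algebraMap ℚ ℂ) := by
  refine ⟨?_, sqrt_two_not_mem_range⟩
  refine ⟨X ^ 2 - C 2, X_pow_sub_C_ne_zero (by norm_num) 2, ?_⟩
  have h2 : ((Real.sqrt 2 : ℝ) : ℂ) ^ 2 = 2 := by
    rw [← Complex.ofReal_pow, Real.sq_sqrt (by norm_num : (0 : ℝ) ≤ 2)]
    norm_num
  simp [h2]

/-- **KERNEL DICTIONARY (critic R2, 2026-08-30 08:42:50Z).**  lens-1 g7's stabilizer predicate «`∃ q ∉ ℚ, q·V ⊆ V`»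
(`SymmetryLayer`, `K_V ≠ ℚ`) and lens-2 g7's `EStable n z` (INLINED on the right: «some irrational ALGEBRAIC β has β z_i ∈ V for all i») agree —
with NO hypothesis on `z`: multipliers of a nonzero finite-dimensional ℚ-span are algebraic (`isAlgebraic_of_mul_mem_span`)
and generators suffice by linearity (`mul_mem_span_of_gens`); the degenerate span `V = 0` makes both sides true. -/
theorem symmetric_iff_eStable (n : ℕ) (z : Fin n → ℂ) :
    (∃ q : ℂ, (∀ v ∈ Submodule.span ℚ (Set.range z), q * v ∈ Submodule.span ℚ (Set.range z)) ∧
        ∀ r : ℚ, (r : ℂ) ≠ q) ↔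
      ∃ β : ℂ, IsAlgebraic ℚ β ∧ β ∉ Set.range (algebraMap ℚ ℂ) ∧
        ∀ i, β * z i ∈ Submodule.span ℚ (Set.range z) := by
  classical
  constructor
  · rintro ⟨q, hq, hne⟩
    by_cases h0 : ∀ i, z i = 0
    · refine ⟨((Real.sqrt 2 : ℝ) : ℂ), sqrt_two_isAlgebraic_irrational.1, sqrt_two_not_mem_range, fun i => ?_⟩
      rw [h0 i, mul_zero]
      exact zero_mem _
    · push Not at h0
      obtain ⟨i₀, hi₀⟩ := h0
      refine ⟨q, isAlgebraic_of_mul_mem_span z q hq (Submodule.subset_span ⟨i₀, rfl⟩) hi₀, ?_, fun i => ?_⟩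
      · rintro ⟨r, hr⟩
        exact hne r (by rw [← hr]; simp)
      · exact hq _ (Submodule.subset_span ⟨i, rfl⟩)
  · rintro ⟨β, -, hβq, hst⟩
    refine ⟨β, fun v hv => mul_mem_span_of_gens hst hv, fun r hr => hβq ⟨r, ?_⟩⟩
    rw [← hr]
    simp

/-- **KERNEL DICTIONARY, complementary side.**  lens-1's «every multiplier of `V` is rational» ⟺ lens-2's `Plain n z` (INLINED on the right) — again with
no hypothesis (for `V = 0` both sides are FALSE: `π`, resp. `√2`, is a non-rational multiplier). -/
theorem asymmetric_iff_plain (n : ℕ) (z : Fin n → ℂ) :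
    (∀ q : ℂ, (∀ v ∈ Submodule.span ℚ (Set.range z), q * v ∈ Submodule.span ℚ (Set.range z)) →
        ∃ r : ℚ, (r : ℂ) = q) ↔
      ∀ β : ℂ, IsAlgebraic ℚ β → (∀ i, β * z i ∈ Submodule.span ℚ (Set.range z)) →
        β ∈ Set.range (algebraMap ℚ ℂ) := by
  classical
  constructor
  · intro h β _ hβV
    obtain ⟨r, hr⟩ := h β (fun v hv => mul_mem_span_of_gens hβV hv)
    exact ⟨r, by rw [← hr]; simp⟩
  · intro hP q hq
    by_cases h0 : ∀ i, z i = 0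
    · exfalso
      have hmem : ∀ i, ((Real.sqrt 2 : ℝ) : ℂ) * z i ∈ Submodule.span ℚ (Set.range z) := fun i => by
        rw [h0 i, mul_zero]
        exact zero_mem _
      exact sqrt_two_not_mem_range (hP _ sqrt_two_isAlgebraic_irrational.1 hmem)
    · push Not at h0
      obtain ⟨i₀, hi₀⟩ := h0
      have halg := isAlgebraic_of_mul_mem_span z q hq (Submodule.subset_span ⟨i₀, rfl⟩) hi₀
      obtain ⟨r, hr⟩ := hP q halg (fun i => hq _ (Submodule.subset_span ⟨i, rfl⟩))
      exact ⟨r, by rw [← hr]; simp⟩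



/-! ## (h) The two round-7 items in lens-1's stabilizer language (FOREST RULING R2 at ITEM level; references the tree decls) -/

/-- `RootDecomp1E.EStableDefectOne` (stmt-Schanuel-31409) ⟺ the same statement with lens-1 g7 `SymmetryLayer`'s hypothesis
«`span_ℚ z` has a non-rational multiplier» in place of `EStable` — by `symmetric_iff_eStable`, pointwise. -/
theorem eStableDefectOne_iff_symmetric :
    Summit.Schanuel.Schanuel.Theses.RootDecomp1E.EStableDefectOne ↔
      ∀ (n : ℕ) (z : Fin n → ℂ), LinearIndependent ℚ z →
        (∃ q : ℂ, (∀ v ∈ Submodule.span ℚ (Set.range z), q * v ∈ Submodule.span ℚ (Set.range z)) ∧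
          ∀ r : ℚ, (r : ℂ) ≠ q) →
        (∀ (m : ℕ) (w : Fin m → ℂ), m < n → LinearIndependent ℚ w →
          (∀ j, w j ∈ Submodule.span ℚ (Set.range z)) →
          (m : Cardinal) ≤ Algebra.trdeg ℚ ↥(IntermediateField.adjoin ℚ
            (Set.range w ∪ Set.range (Complex.exp ∘ w))) + 1) →
        (n : Cardinal) ≤ Algebra.trdeg ℚ ↥(IntermediateField.adjoin ℚ
          (Set.range z ∪ Set.range (Complex.exp ∘ z))) + 1 := by
  constructor
  · intro h n z hz hs hsub
    exact h n z hz ((symmetric_iff_eStable n z).mp hs) hsub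
  · intro h n z hz hE hsub
    exact h n z hz ((symmetric_iff_eStable n z).mpr hE) hsub

/-- `RootDecomp1E.PlainDefectOne` (stmt-Schanuel-31410) ⟺ the same statement with lens-1's «every multiplier of `span_ℚ z` is
rational» in place of `Plain` — by `asymmetric_iff_plain`, pointwise. -/
theorem plainDefectOne_iff_asymmetric :
    Summit.Schanuel.Schanuel.Theses.RootDecomp1E.PlainDefectOne ↔
      ∀ (n : ℕ) (z : Fin n → ℂ), LinearIndependent ℚ z →
        (∀ q : ℂ, (∀ v ∈ Submodule.span ℚ (Set.range z), q * v ∈ Submodule.span ℚ (Set.range z)) →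
          ∃ r : ℚ, (r : ℂ) = q) →
        (∀ (m : ℕ) (w : Fin m → ℂ), m < n → LinearIndependent ℚ w →
          (∀ j, w j ∈ Submodule.span ℚ (Set.range z)) →
          (m : Cardinal) ≤ Algebra.trdeg ℚ ↥(IntermediateField.adjoin ℚ
            (Set.range w ∪ Set.range (Complex.exp ∘ w))) + 1) →
        (n : Cardinal) ≤ Algebra.trdeg ℚ ↥(IntermediateField.adjoin ℚ
          (Set.range z ∪ Set.range (Complex.exp ∘ z))) + 1 := by
  constructor
  · intro h n z hz ha hsub
    exact h n z hz ((asymmetric_iff_plain n z).mp ha) hsub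
  · intro h n z hz hP hsub
    exact h n z hz ((asymmetric_iff_plain n z).mpr hP) hsub

end Summit.Schanuel.Schanuel.Theorems.RootDecomp1EMultiplicationTypeLeaves

end
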